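import Literature.NumberTheory.Automorphic.UnitaryGroupAdelicDet
import Literature.LinearAlgebra.Matrix.DiagonalTorusGL
import HarnessLib

/-!
# The diagonal section `u ↦ diag(1, …, u, …, 1)` of `det : U(diag d)(𝔸_F) → U(1)(𝔸_F)`

For a quadratic extension `E/F` of number fields with conjugation `c`, a DIAGONAL hermitian form
`J = diagonal d` (`d : Fin N → E`) and a slot `i : Fin N`, the norm-one idèles `u ∈ U(1)(𝔸_F)`
(`UnitaryGroup.adelicOne F E c = {u ∈ 𝔸_Eˣ | (c ⊗ 1)(u) · u = 1}`, [Mok2014, §1 Notation p. 5]: the centre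
`U_{E/F}(1)` of every `U_{E/F}(N)`, and the unitary group of every hermitian LINE) embed into `U(J)(𝔸_F)` as the
unitary group of the `i`-th line of the orthogonal decomposition `E e_0 ⊕ ⋯ ⊕ E e_{N-1}`:

* `UnitaryGroup.adelicDiagSection F E c N d i : adelicOne F E c →* adelic F E c N (Matrix.diagonal d)`,
  `u ↦ diagonal (mulSingle i u) = diag(1, …, u, …, 1)` (`coe_adelicDiagSection`, `coe_coe_adelicDiagSection`);
* it is a SECTION of the determinant: `adelicDet (adelicDiagSection u) = u` (`adelicDet_adelicDiagSection`,
  `adelicDet_comp_adelicDiagSection`), hence `det : U(J)(𝔸_F) → U(1)(𝔸_F)` is onto for diagonal `J`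
  (`adelicDet_surjective_of_diagonal`);
* it is continuous (`continuous_adelicDiagSection`);
* it takes PRINCIPAL norm-one idèles to RATIONAL points: if the idèle `u` is principal then
  `adelicDiagSection u ∈ (toAdelic F E c N (diagonal d)).range` (`adelicDiagSection_mem_range_toAdelic`).

This is the `sec` input of the factorisation `χ = (χ ∘ sec) ∘ det` of continuous characters of `U(diag d)(𝔸_F)`
(`UnitaryGroupAdelicCharactersDet`, rank `3`, CM case) and of its consumer `UnitaryGroupPairCharactersDet`
([GelbartRogawski1991, §3.1 Remark p. 457 L9–13]: a second compatible splitting differs from the first by an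
automorphic character of `E¹ = U(1)` "regarded as a character of `G`", i.e. composed with `det`; the section makes
`ν′ = χ ∘ sec` explicit).  Elementary matrix algebra over the tree's `DiagonalTorusGL`
(`diagGL_unitary_of_mul_conj_eq_one`: norm-one diagonal units preserve every diagonal form); kernel only:
0 records, 0 named facts, 0 sorry.
-/

set_option autoImplicit false

noncomputable section

open NumberField
open Literature.LinearAlgebra.Matrix

namespace Literature.NumberTheory.Automorphic

namespace UnitaryGroup

section DiagSection

variable (F E : Type) [Field F] [Field E] [NumberField E] [Algebra F E] (c : E ≃ₐ[F] E)
variable (N : ℕ) (d : Fin N → E) (i : Fin N)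

/-- the adelic form of a diagonal form is the diagonal form of the embedded entries. [folklore] -/
private theorem adelicForm_diagonal :
    adelicForm E N (Matrix.diagonal d) = Matrix.diagonal fun k => algebraMap E (AdeleRing (𝓞 E) E) (d k) := by
  rw [adelicForm, Matrix.diagonal_map (map_zero _)]

/-- **`diag(1, …, u, …, 1) ∈ U(diag d)(𝔸_F)` for a norm-one idèle `u`**: a diagonal matrix of norm-one units
preserves every diagonal hermitian form. [cite: Mok2014, §1 Notation p. 5] -/
theorem diagGL_mulSingle_mem_adelic (u : adelicOne F E c) :
    DiagonalTorus.diagGL (Fin N) (Pi.mulSingle i (u : (AdeleRing (𝓞 E) E)ˣ)) ∈ adelic F E c N (Matrix.diagonal d) := by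
  rw [adelic, mem_unitaryGroupOfForm_iff, adelicForm_diagonal]
  refine DiagonalTorus.diagGL_unitary_of_mul_conj_eq_one (conjAdele F E c) _ _ fun k => ?_
  by_cases hk : k = i
  · subst hk
    rw [Pi.mulSingle_eq_same, mul_comm]
    exact u.2
  · rw [Pi.mulSingle_eq_of_ne hk, Units.val_one, map_one, mul_one]

/-- **The diagonal section** `u ↦ diag(1, …, u, …, 1)` (`u` in slot `i`) :
`U(1)(𝔸_F) →* U(diag d)(𝔸_F)` — the unitary group of the `i`-th line of the orthogonal sum
`⊕_k E e_k` with `⟨e_k, e_k⟩ = d_k`. [cite: Mok2014, §1 Notation p. 5] -/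
def adelicDiagSection : adelicOne F E c →* adelic F E c N (Matrix.diagonal d) :=
  MonoidHom.codRestrict
    ((DiagonalTorus.diagGL (Fin N)).comp
      ((MonoidHom.mulSingle (fun _ : Fin N => (AdeleRing (𝓞 E) E)ˣ) i).comp (adelicOne F E c).subtype))
    (adelic F E c N (Matrix.diagonal d)) fun u => diagGL_mulSingle_mem_adelic F E c N d i u

/-- underlying invertible matrix of `adelicDiagSection u`: `diagGL (mulSingle i u)`. [cite: Mok2014, §1 Notation p. 5] -/
@[simp] theorem coe_adelicDiagSection (u : adelicOne F E c) :
    ((adelicDiagSection F E c N d i u : adelic F E c N (Matrix.diagonal d)) : GL (Fin N) (AdeleRing (𝓞 E) E)) =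
      DiagonalTorus.diagGL (Fin N) (Pi.mulSingle i (u : (AdeleRing (𝓞 E) E)ˣ)) :=
  rfl

/-- entries of `mulSingle i u` as adeles: `mulSingle i (u : 𝔸_E)`. [folklore] -/
private theorem val_mulSingle (u : (AdeleRing (𝓞 E) E)ˣ) (k : Fin N) :
    ((Pi.mulSingle (M := fun _ : Fin N => (AdeleRing (𝓞 E) E)ˣ) i u k : (AdeleRing (𝓞 E) E)ˣ) : AdeleRing (𝓞 E) E) =
      Pi.mulSingle (M := fun _ : Fin N => AdeleRing (𝓞 E) E) i (u : AdeleRing (𝓞 E) E) k := by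
  by_cases hk : k = i
  · subst hk
    rw [Pi.mulSingle_eq_same, Pi.mulSingle_eq_same]
  · rw [Pi.mulSingle_eq_of_ne hk, Pi.mulSingle_eq_of_ne hk, Units.val_one]

/-- underlying matrix of `adelicDiagSection u`: `diagonal (mulSingle i u) = diag(1, …, u, …, 1)`. [cite: Mok2014, §1 Notation p. 5] -/
theorem coe_coe_adelicDiagSection (u : adelicOne F E c) :
    (((adelicDiagSection F E c N d i u : adelic F E c N (Matrix.diagonal d)) : GL (Fin N) (AdeleRing (𝓞 E) E)) :
        Matrix (Fin N) (Fin N) (AdeleRing (𝓞 E) E)) =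
      Matrix.diagonal (Pi.mulSingle i (((u : (AdeleRing (𝓞 E) E)ˣ) : AdeleRing (𝓞 E) E))) := by
  rw [coe_adelicDiagSection, DiagonalTorus.val_diagGL]
  exact congrArg Matrix.diagonal (funext fun k => val_mulSingle E N i _ k)

/-- `det (diag(1, …, u, …, 1)) = u` in `𝔸_Eˣ`. [cite: Mok2014, §1 Notation p. 5] -/
theorem det_coe_adelicDiagSection (u : adelicOne F E c) :
    Matrix.GeneralLinearGroup.det
        ((adelicDiagSection F E c N d i u : adelic F E c N (Matrix.diagonal d)) : GL (Fin N) (AdeleRing (𝓞 E) E)) =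
      (u : (AdeleRing (𝓞 E) E)ˣ) := by
  apply Units.ext
  rw [Matrix.GeneralLinearGroup.val_det_apply, coe_coe_adelicDiagSection, Matrix.det_diagonal]
  exact Fintype.prod_pi_mulSingle' i _

/-- **`adelicDiagSection` is a section of `det`**: `adelicDet (diag(1, …, u, …, 1)) = u`.
[cite: Mok2014, §1 Notation p. 5] -/
@[simp] theorem adelicDet_adelicDiagSection (hJ : (Matrix.diagonal d).det ≠ 0) (u : adelicOne F E c) :
    adelicDet F E c N (Matrix.diagonal d) hJ (adelicDiagSection F E c N d i u) = u :=
  Subtype.ext (det_coe_adelicDiagSection F E c N d i u)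

/-- as homomorphisms: `det ∘ sec = id` on `U(1)(𝔸_F)`. [cite: Mok2014, §1 Notation p. 5] -/
theorem adelicDet_comp_adelicDiagSection (hJ : (Matrix.diagonal d).det ≠ 0) :
    (adelicDet F E c N (Matrix.diagonal d) hJ).comp (adelicDiagSection F E c N d i) = MonoidHom.id _ :=
  MonoidHom.ext fun u => adelicDet_adelicDiagSection F E c N d i hJ u

/-- hence **`det : U(diag d)(𝔸_F) → U(1)(𝔸_F)` is surjective** (for `N ≥ 1`, witnessed by the slot `i`).
[cite: Mok2014, §1 Notation p. 5] -/
theorem adelicDet_surjective_of_diagonal [NeZero N] (hJ : (Matrix.diagonal d).det ≠ 0) :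
    Function.Surjective (adelicDet F E c N (Matrix.diagonal d) hJ) :=
  fun u => ⟨adelicDiagSection F E c N d 0 u, adelicDet_adelicDiagSection F E c N d 0 hJ u⟩

/-- **`adelicDiagSection` is continuous** (units topologies: `diagGL` and `mulSingle` are continuous). [cite: Mok2014, §1 Notation p. 5] -/
theorem continuous_adelicDiagSection : Continuous (adelicDiagSection F E c N d i) :=
  (DiagonalTorus.continuous_diagGL.comp ((_root_.continuous_mulSingle i).comp continuous_subtype_val)).subtype_mk _

/-- a principal norm-one idèle `u = (x)_𝔸`, `x ∈ Eˣ`, has `c(x) · x = 1` in `E`. [folklore] -/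
private theorem conj_mul_eq_one_of_eq_algebraMap (u : adelicOne F E c) (x : Eˣ)
    (hx : Units.map (algebraMap E (AdeleRing (𝓞 E) E) : E →* AdeleRing (𝓞 E) E) x = (u : (AdeleRing (𝓞 E) E)ˣ)) :
    (c : E →+* E) x * x = 1 := by
  haveI : Nontrivial (AdeleRing (𝓞 E) E) :=
    inferInstanceAs (Nontrivial (InfiniteAdeleRing E × IsDedekindDomain.FiniteAdeleRing (𝓞 E) E))
  apply (algebraMap E (AdeleRing (𝓞 E) E)).injective
  have hu : conjAdele F E c ((u : (AdeleRing (𝓞 E) E)ˣ) : AdeleRing (𝓞 E) E) * (u : (AdeleRing (𝓞 E) E)ˣ) = 1 := u.2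
  have hxu : algebraMap E (AdeleRing (𝓞 E) E) (x : E) = ((u : (AdeleRing (𝓞 E) E)ˣ) : AdeleRing (𝓞 E) E) :=
    congrArg Units.val hx
  rw [map_mul, map_one, algebraMap_conj F E c, hxu, hu]

/-- **principal idèles go to rational points**: if the norm-one idèle `u` is principal, `u = (x)_𝔸` with `x ∈ Eˣ`
(then `c(x) x = 1`), the element `diag(1, …, u, …, 1)` is the image of the rational point `diag(1, …, x, …, 1) ∈ U(diag d)(F)`
under the diagonal embedding `toAdelic`. [cite: Mok2014, §1 Notation p. 5] -/
theorem adelicDiagSection_mem_range_toAdelic (u : adelicOne F E c)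
    (hu : (u : (AdeleRing (𝓞 E) E)ˣ) ∈ Literature.NumberTheory.GaloisRepresentations.principalIdeles E) :
    adelicDiagSection F E c N d i u ∈ (toAdelic F E c N (Matrix.diagonal d)).range := by
  obtain ⟨x, hx⟩ := hu
  have hx1 : (c : E →+* E) x * x = 1 := conj_mul_eq_one_of_eq_algebraMap F E c u x hx
  have hγ : DiagonalTorus.diagGL (Fin N) (Pi.mulSingle i x) ∈ rational F E c N (Matrix.diagonal d) := by
    rw [rational, mem_unitaryGroupOfForm_iff]
    refine DiagonalTorus.diagGL_unitary_of_mul_conj_eq_one (c : E →+* E) _ _ fun k => ?_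
    by_cases hk : k = i
    · subst hk
      rw [Pi.mulSingle_eq_same, mul_comm]
      exact hx1
    · rw [Pi.mulSingle_eq_of_ne hk, Units.val_one, map_one, mul_one]
  refine ⟨⟨_, hγ⟩, Subtype.ext ?_⟩
  show Matrix.GeneralLinearGroup.map (algebraMap E (AdeleRing (𝓞 E) E)) (DiagonalTorus.diagGL (Fin N) (Pi.mulSingle i x)) =
    DiagonalTorus.diagGL (Fin N) (Pi.mulSingle i (u : (AdeleRing (𝓞 E) E)ˣ))
  rw [Matrix.GeneralLinearGroup.map, DiagonalTorus.map_diagGL]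
  congr 1
  funext k
  rw [← hx]
  by_cases hk : k = i
  · subst hk
    rw [Pi.mulSingle_eq_same, Pi.mulSingle_eq_same]
  · rw [Pi.mulSingle_eq_of_ne hk, Pi.mulSingle_eq_of_ne hk, map_one]

/-- the same with the principal idèle given by a witness `x ∈ Eˣ`. [cite: Mok2014, §1 Notation p. 5] -/
theorem adelicDiagSection_mem_range_toAdelic_of_eq (u : adelicOne F E c) (x : Eˣ)
    (hx : Units.map (algebraMap E (AdeleRing (𝓞 E) E) : E →* AdeleRing (𝓞 E) E) x = (u : (AdeleRing (𝓞 E) E)ˣ)) :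
    adelicDiagSection F E c N d i u ∈ (toAdelic F E c N (Matrix.diagonal d)).range :=
  adelicDiagSection_mem_range_toAdelic F E c N d i u ⟨x, hx⟩

end DiagSection

end UnitaryGroup

end Literature.NumberTheory.Automorphic

end
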